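import Summits.BirchSwinnertonDyer.BirchSwinnertonDyer.Theorems.CyclotomicUntwistSigmaLineFamilyFormal
import Literature.NumberTheory.EllipticCurves.FormalGroupLawAxiomsUniversalProofs
import Literature.RingTheory.FormalGroups.FunctionalEquationIntegrality
import HarnessLib

/-!
# Route `CyclotomicUntwist`, crux K1 `PSRankOneLowerHalfAtThree` (stmt-BirchSwinnertonDyer-21580):
# the σ-LINE FAMILY — uniqueness keyed on `[t²]` and the EXP-REPRESENTATION `formalSigma V c = t·exp(Ψ)`

Cell `pub/bsd-wall` (D-0145 line `route-BirchSwinnertonDyer-CyclotomicUntwist`), seat `bsd-line-cycu-p1`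
g4 (K1 base). THEOREMS ONLY (no definition, no named fact, no `sorry`); helper `--supports` K1 =
stmt-BirchSwinnertonDyer-21580. Prepares `CyclotomicUntwistSigmaLineFamilyConvergence.lean` (the crude
Bernardi convergence of every member `formalSigma V c`, `‖c‖ ≤ 1`, which DISCHARGES the convergence
hypotheses of the height difference law / Perrin-Riou dichotomy of `…SigmaLineFamilyValues.lean`). BSD is
not proved by this file and nothing here is evidence for or against K1/K2.

* §1 `eq_of_satisfiesSigmaODE_of_coeff_two_eq` — two normalised solutions of `x + c = −D(Dσ/σ)` with the
  same `t²`-coefficient coincide (the tree's Wronskian argument `eq_of_satisfiesSigmaODE_of_isFormallyOdd`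
  with its single use of oddness, `2[t²]σ = a₁`, replaced by the hypothesis; Mazur–Stein–Tate's "second
  constant of integration"); `eq_formalSigma_of_coeff_two`.
* §2 `coeff_one_formalOmega : [t¹]ω = a₁` (from `log ∘ [−1] = −log`); the right side `h = ω(t²x + ct²)`
  has `h₀ = 1`, `h₁ = 0`.
* §3 **`exists_exp_representation`**: `formalSigma V c = t·exp(Ψ)` with `Ψ = Σ_{n≥1}(Gₙ/n)tⁿ`, `G = g·ω`,
  `g = 1 − (a₁/2)t − Σ_{n≥2} hₙ/(n−1)·tⁿ` — the solution written as in Mazur–Tate 1991 §3 /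
  Mazur–Stein–Tate 2006 §3.1 (`g − tg′ = h`, `tΨ′ = G − 1`, `sigmaG(t e^Ψ) = g`), with the coefficient
  formulas exported for the bounds of the sequel.

References: Mazur–Tate, Duke Math. J. 62 (1991) §3; Mazur–Stein–Tate, Doc. Math. Extra Vol. (2006)
Thm. 1.3, Rem. 1.4, §3.1; Bernardi, Progr. Math. 12 (1981) §1; Silverman AEC IV.1, IV.4.
[cite: MazurSteinTate2006, Thm. 1.3] [cite: MazurTate1991, Thm. 3.1] [cite: SilvermanAEC2009, IV.4.2]
-/

set_option autoImplicit false
set_option linter.dupNamespace false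

noncomputable section

open scoped Classical Nat

open PowerSeries WeierstrassCurve Literature.NumberTheory.EllipticCurves Literature.RingTheory.FormalGroups

namespace Summit.BirchSwinnertonDyer.BirchSwinnertonDyer.Theorems.PSSigmaLineFamilyExpRepresentation

open Summit.BirchSwinnertonDyer.BirchSwinnertonDyer.Theorems.PSSigmaLineFamily

variable {p : ℕ} [Fact p.Prime] (V : WeierstrassCurve ℚ_[p])

/-! ### §1 Uniqueness keyed on the `t²`-coefficient (the constant of integration `g₁`) -/

/-- **Two normalised solutions of the sigma equation with the same constant AND the same
`t²`-coefficient coincide** (no oddness, no integrality): the difference of the pole-cleared equations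
gives `g₁ − g₂ = κt` with `κ = [t²]σ₁ − [t²]σ₂ = 0`, then the Wronskian argument. This is the tree's
`eq_of_satisfiesSigmaODE_of_isFormallyOdd` with its only use of oddness (`2[t²]σ = a₁`) replaced by the
hypothesis. [Mazur–Tate 1991, Thm. 3.1 (proof); Mazur–Stein–Tate 2006, §3.1 (two constants of integration)]
[cite: MazurSteinTate2006, Thm. 1.3] -/
theorem eq_of_satisfiesSigmaODE_of_coeff_two_eq {σ₁ σ₂ : ℚ_[p]⟦X⟧} {c : ℚ_[p]}
    (h10 : constantCoeff σ₁ = 0) (h11 : coeff 1 σ₁ = 1) (hODE1 : V.SatisfiesSigmaODE σ₁ c)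
    (h20 : constantCoeff σ₂ = 0) (h21 : coeff 1 σ₂ = 1) (hODE2 : V.SatisfiesSigmaODE σ₂ c)
    (h22 : coeff 2 σ₁ = coeff 2 σ₂) : σ₁ = σ₂ := by
  -- adapted from Literature/NumberTheory/EllipticCurves/PadicSigmaSqUniquenessProofs.lean
  set s₁ := sigmaShift σ₁ with hs₁
  set s₂ := sigmaShift σ₂ with hs₂
  have hcoeff : ∀ k, coeff (k + 2) (V.sigmaG σ₁ - V.sigmaG σ₂) = 0 := fun k => by
    have e := V.sub_mul_coeff_formalOmega_of_ode hODE1 hODE2 k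
    rw [sub_self, zero_mul, zero_eq_neg] at e
    exact (mul_eq_zero.mp e).resolve_left (Nat.cast_add_one_ne_zero k)
  set κ : ℚ_[p] := coeff 1 (V.sigmaG σ₁ - V.sigmaG σ₂) with hκ
  have hg : V.sigmaG σ₁ = V.sigmaG σ₂ + C κ * X := by
    rw [← sub_eq_iff_eq_add']
    ext n
    rcases n with _ | _ | k
    · rw [coeff_zero_eq_constantCoeff_apply, map_sub, V.constantCoeff_sigmaG h11,
        V.constantCoeff_sigmaG h21, sub_self, coeff_zero_eq_constantCoeff_apply]
      simp
    · simp [hκ]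
    · rw [hcoeff k, coeff_C_mul, coeff_X, if_neg (by omega), mul_zero]
  have E1 := V.sigmaG_mul h11
  have E2 := V.sigmaG_mul h21
  rw [hg] at E1
  have hW : C κ * V.formalOmega * s₁ * s₂ = d⁄dX ℚ_[p] s₁ * s₂ - d⁄dX ℚ_[p] s₂ * s₁ := by
    apply mul_left_cancel₀ (X_ne_zero (R := ℚ_[p]))
    calc X * (C κ * V.formalOmega * s₁ * s₂)
        = (V.sigmaG σ₂ + C κ * X) * (V.formalOmega * s₁) * s₂ -
            V.sigmaG σ₂ * (V.formalOmega * s₂) * s₁ := by ring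
      _ = (s₁ + X * d⁄dX ℚ_[p] s₁) * s₂ - (s₂ + X * d⁄dX ℚ_[p] s₂) * s₁ := by rw [E1, E2]
      _ = X * (d⁄dX ℚ_[p] s₁ * s₂ - d⁄dX ℚ_[p] s₂ * s₁) := by ring
  have hκ0 : κ = 0 := by
    have e := congrArg constantCoeff hW
    simp only [map_mul, map_sub, constantCoeff_C, V.constantCoeff_formalOmega, hs₁, hs₂,
      constantCoeff_sigmaShift, h11, h21, mul_one, constantCoeff_derivative, coeff_sigmaShift, h22,
      sub_self] at e
    exact e
  rw [hκ0, map_zero, zero_mul, zero_mul, zero_mul, eq_comm, sub_eq_zero] at hW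
  have hs₂0 : constantCoeff s₂ = 1 := by rw [hs₂, constantCoeff_sigmaShift, h21]
  have hv : s₂ * invOfUnit s₂ 1 = 1 := mul_invOfUnit s₂ 1 (by rw [hs₂0, Units.val_one])
  set v := invOfUnit s₂ 1 with hvdef
  have hdv : s₂ * d⁄dX ℚ_[p] v + v * d⁄dX ℚ_[p] s₂ = 0 := by
    have e := congrArg (d⁄dX ℚ_[p]) hv
    rwa [Derivation.leibniz, smul_eq_mul, smul_eq_mul, Derivation.map_one_eq_zero] at e
  have hdu : d⁄dX ℚ_[p] (s₁ * v) = 0 := by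
    have hs₂ne : s₂ ≠ 0 := fun h0 => by rw [h0, map_zero] at hs₂0; exact zero_ne_one hs₂0
    refine (mul_eq_zero.mp ?_).resolve_left hs₂ne
    calc s₂ * d⁄dX ℚ_[p] (s₁ * v)
        = v * (d⁄dX ℚ_[p] s₁ * s₂ - d⁄dX ℚ_[p] s₂ * s₁) +
            s₁ * (s₂ * d⁄dX ℚ_[p] v + v * d⁄dX ℚ_[p] s₂) := by
          rw [Derivation.leibniz, smul_eq_mul, smul_eq_mul]; ring
      _ = 0 := by rw [hW, hdv, sub_self, mul_zero, mul_zero, add_zero]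
  have hu : s₁ * v = 1 := by
    ext n
    rcases n with _ | n
    · rw [coeff_zero_eq_constantCoeff_apply, coeff_zero_eq_constantCoeff_apply, map_mul, map_one,
        hs₁, constantCoeff_sigmaShift, h11, one_mul, hvdef, constantCoeff_invOfUnit, inv_one,
        Units.val_one]
    · have e := congrArg (coeff n) hdu
      rw [coeff_derivative, map_zero] at e
      rw [coeff_one, if_neg (Nat.succ_ne_zero n)]
      exact (mul_eq_zero.mp e).resolve_right (Nat.cast_add_one_ne_zero n)
  have hss : s₁ = s₂ := by
    calc s₁ = s₁ * (s₂ * v) := by rw [hv, mul_one]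
      _ = (s₁ * v) * s₂ := by ring
      _ = s₂ := by rw [hu, one_mul]
  rw [← X_mul_sigmaShift h10, ← X_mul_sigmaShift h20, ← hs₁, ← hs₂, hss]

/-- A normalised solution with `[t²]σ = a₁/2` IS `formalSigma V c` (`coeff_two_formalSigma`).
[Mazur–Stein–Tate 2006, Thm. 1.3, Rem. 1.4] [cite: MazurSteinTate2006, Rem. 1.4] -/
theorem eq_formalSigma_of_coeff_two {σ : ℚ_[p]⟦X⟧} {c : ℚ_[p]} (h0 : constantCoeff σ = 0)
    (h1 : coeff 1 σ = 1) (hODE : V.SatisfiesSigmaODE σ c) (h2 : coeff 2 σ = V.a₁ / 2) :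
    σ = V.formalSigma c :=
  eq_of_satisfiesSigmaODE_of_coeff_two_eq V h0 h1 hODE (constantCoeff_formalSigma V c)
    (coeff_one_formalSigma V c) (satisfiesSigmaODE_formalSigma V c)
    (by rw [h2, coeff_two_formalSigma])

/-! ### §2 The invariant differential starts `ω = 1 + a₁t + ⋯`; the right side `h = ω·(t²x + ct²)` -/

/-- `[t¹]ω = a₁` (from `log_W ∘ i = −log_W`: `2[t²]log_W = a₁`, and `[t²]log_W = [t¹]ω/2`).
[Silverman AEC IV.1 (`ω(z) = 1 + a₁z + ⋯`)] [cite: SilvermanAEC2009, IV.4.2] -/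
theorem coeff_one_formalOmega : coeff 1 V.formalOmega = V.a₁ := by
  have hodd : V.IsFormallyOdd V.formalLog := V.formalLog_subst_formalNeg
  have h2 := V.two_mul_coeff_two_of_isFormallyOdd hodd V.constantCoeff_formalLog V.coeff_one_formalLog
  have hL : coeff 2 V.formalLog = algebraMap ℚ ℚ_[p] (1 / (0 + 2 : ℚ)) * coeff (0 + 1) V.formalOmega := by
    rw [formalLog, coeff_mk]; rfl
  rw [hL, zero_add, zero_add, map_div₀, map_one, map_ofNat] at h2
  linear_combination h2

/-- `h := ω·(t²x + ct²)` has constant term `1`. [folklore] -/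
theorem constantCoeff_rhs (c : ℚ_[p]) :
    constantCoeff (V.formalOmega * (V.formalXMulSq + C c * X ^ 2)) = 1 := by
  rw [map_mul, V.constantCoeff_formalOmega, map_add, V.constantCoeff_formalXMulSq, map_mul, map_pow,
    constantCoeff_X, zero_pow two_ne_zero, mul_zero, add_zero, one_mul]

/-- `[t¹]h = 0` — read off from the EXISTENCE of a solution (`formalSigma V c`): the right side of
`h = g − tg′` has no linear term. [folklore] -/
theorem coeff_one_rhs (c : ℚ_[p]) : coeff 1 (V.formalOmega * (V.formalXMulSq + C c * X ^ 2)) = 0 := by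
  have hODE := satisfiesSigmaODE_formalSigma V c
  rw [satisfiesSigmaODE_iff] at hODE
  rw [hODE, map_sub, coeff_succ_X_mul, coeff_derivative]
  simp

/-! ### §3 The explicit solution `t·exp(Ψ)` and the exp-representation of `formalSigma V c` -/

/-- **THE EXP-REPRESENTATION `formalSigma V c = t·exp(Ψ)`.** Let `h = ω(t²x + ct²) = Σ hₙtⁿ`,
`g = 1 − (a₁/2)t − Σ_{n≥2} hₙ/(n−1)·tⁿ` (so `g − tg′ = h`), `G = g·ω = 1 + Σ_{n≥1} Gₙtⁿ` and
`Ψ = Σ_{n≥1} (Gₙ/n) tⁿ` (so `tΨ′ = G − 1`). Then `σ := t·exp(Ψ)` is a normalised solution of the sigma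
equation with constant `c` (`s = exp Ψ` has `s + ts′ = G·s`, whence `sigmaG σ = g`) and `[t²]σ = a₁/2`, so
`σ = formalSigma V c` by §1. Stated as an existence of `Ψ` with its DEFINING coefficient formula, for the
bounds of §4. [Mazur–Tate 1991, §3; Mazur–Stein–Tate 2006, §3.1 (`σ = t·exp(…)`); Bernardi 1981]
[cite: MazurSteinTate2006, Thm. 1.3] -/
theorem exists_exp_representation (c : ℚ_[p]) :
    ∃ g Ψ : ℚ_[p]⟦X⟧,
      constantCoeff g = 1 ∧ coeff 1 g = -(V.a₁ / 2) ∧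
      (∀ n : ℕ, 2 ≤ n → coeff n g =
        -(coeff n (V.formalOmega * (V.formalXMulSq + C c * X ^ 2))) / ((n : ℚ_[p]) - 1)) ∧
      constantCoeff Ψ = 0 ∧
      (∀ n : ℕ, 1 ≤ n → coeff n Ψ = coeff n (g * V.formalOmega) / (n : ℚ_[p])) ∧
      V.formalSigma c = X * (exp ℚ_[p]).subst Ψ := by
  set h := V.formalOmega * (V.formalXMulSq + C c * X ^ 2) with hh
  set g : ℚ_[p]⟦X⟧ := PowerSeries.mk fun n =>
    if n = 0 then 1 else if n = 1 then -(V.a₁ / 2) else -(coeff n h) / ((n : ℚ_[p]) - 1) with hg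
  set G := g * V.formalOmega with hG
  set Ψ : ℚ_[p]⟦X⟧ := PowerSeries.mk fun n => if n = 0 then 0 else coeff n G / (n : ℚ_[p]) with hΨ
  have hg0 : constantCoeff g = 1 := by rw [← coeff_zero_eq_constantCoeff_apply, hg, coeff_mk]; simp
  have hg1 : coeff 1 g = -(V.a₁ / 2) := by rw [hg, coeff_mk]; simp
  have hgn : ∀ n : ℕ, 2 ≤ n → coeff n g = -(coeff n h) / ((n : ℚ_[p]) - 1) := by
    intro n hn; rw [hg, coeff_mk, if_neg (by omega), if_neg (by omega)]
  have hΨ0 : constantCoeff Ψ = 0 := by rw [← coeff_zero_eq_constantCoeff_apply, hΨ, coeff_mk]; simp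
  have hΨn : ∀ n : ℕ, 1 ≤ n → coeff n Ψ = coeff n G / (n : ℚ_[p]) := by
    intro n hn; rw [hΨ, coeff_mk, if_neg (by omega)]
  have hG0 : constantCoeff G = 1 := by rw [hG, map_mul, hg0, V.constantCoeff_formalOmega, one_mul]
  refine ⟨g, Ψ, hg0, hg1, hgn, hΨ0, hΨn, ?_⟩
  -- `s := exp Ψ`, `σ := X s`
  set s := (exp ℚ_[p]).subst Ψ with hs
  have hs0 : constantCoeff s = 1 := constantCoeff_exp_subst hΨ0
  -- `X Ψ' = G - 1`
  have hXΨ : X * d⁄dX ℚ_[p] Ψ = G - 1 := by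
    ext n
    rcases n with _ | n
    · rw [coeff_zero_X_mul, map_sub, coeff_zero_eq_constantCoeff_apply, hG0, coeff_zero_eq_constantCoeff,
        map_one]; simp
    · rw [coeff_succ_X_mul, coeff_derivative, map_sub, coeff_one, if_neg (Nat.succ_ne_zero n), sub_zero,
        hΨn (n + 1) (by omega)]
      have : ((n + 1 : ℕ) : ℚ_[p]) ≠ 0 := by exact_mod_cast Nat.succ_ne_zero n
      field_simp
      push_cast
      ring
  -- `s + X s' = G s`
  have hsG : s + X * d⁄dX ℚ_[p] s = G * s := by
    rw [hs, derivative_exp_subst hΨ0, ← hs]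
    calc s + X * (s * d⁄dX ℚ_[p] Ψ) = s * (1 + X * d⁄dX ℚ_[p] Ψ) := by ring
      _ = G * s := by rw [hXΨ]; ring
  -- `σ := X s` is normalised with `sigmaShift σ = s`
  have hshift : sigmaShift (X * s) = s := by
    ext n; rw [coeff_sigmaShift, coeff_succ_X_mul]
  have hσ0 : constantCoeff (X * s) = 0 := by rw [map_mul, constantCoeff_X, zero_mul]
  have hσ1 : coeff 1 (X * s) = 1 := by rw [coeff_succ_X_mul, coeff_zero_eq_constantCoeff_apply, hs0]
  have hσ2 : coeff 2 (X * s) = V.a₁ / 2 := by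
    rw [coeff_succ_X_mul]
    -- `[t¹]s = [t¹]Ψ = G₁ = g₀ω₁ + g₁ω₀ = a₁ - a₁/2`
    rw [hs, coeff_one_exp_subst hΨ0, hΨn 1 le_rfl, Nat.cast_one, div_one, hG, coeff_one_mul_eq,
      coeff_zero_eq_constantCoeff_apply, hg0, coeff_one_formalOmega, hg1, coeff_zero_eq_constantCoeff_apply,
      V.constantCoeff_formalOmega]
    ring
  -- `sigmaG σ = g`
  have hgσ : V.sigmaG (X * s) = g := by
    have hunit : V.formalOmega * s * invOfUnit (V.formalOmega * s) 1 = 1 :=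
      mul_invOfUnit _ 1 (by rw [map_mul, V.constantCoeff_formalOmega, hs0, mul_one, Units.val_one])
    rw [sigmaG, hshift, hsG, hG]
    calc g * V.formalOmega * s * invOfUnit (V.formalOmega * s) 1
        = g * (V.formalOmega * s * invOfUnit (V.formalOmega * s) 1) := by ring
      _ = g := by rw [hunit, mul_one]
  -- the ODE: `h = g - X g'` coefficientwise
  have hODE : V.SatisfiesSigmaODE (X * s) c := by
    rw [satisfiesSigmaODE_iff, hgσ, ← hh]
    ext n
    rw [map_sub]
    rcases n with _ | n
    · rw [coeff_zero_X_mul, sub_zero, coeff_zero_eq_constantCoeff_apply, coeff_zero_eq_constantCoeff_apply,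
        hh, constantCoeff_rhs, hg0]
    · rw [coeff_succ_X_mul, coeff_derivative]
      rcases n with _ | n
      · -- n = 1
        have h1 : coeff (0 + 1) h = 0 := by rw [zero_add, hh]; exact coeff_one_rhs V c
        rw [h1]; push_cast; ring
      · rw [hgn (n + 2) (by omega)]
        have : ((n + 2 : ℕ) : ℚ_[p]) - 1 ≠ 0 := by
          rw [sub_ne_zero]; exact_mod_cast (show n + 2 ≠ 1 by omega)
        field_simp
        push_cast
        ring
  exact (eq_formalSigma_of_coeff_two V hσ0 hσ1 hODE hσ2).symm


end Summit.BirchSwinnertonDyer.BirchSwinnertonDyer.Theorems.PSSigmaLineFamilyExpRepresentation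

end
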